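import Summits.QuantumFields.YangMills.Theorems.SwapVirialDeficitSectorLaplaceTipPXAxialCones
import Summits.QuantumFields.YangMills.Theorems.SwapVirialDeficitSectorLaplaceTipCoreRegionsPrelims
import HarnessLib

/-!
# Route `SwapVirialDeficit` (YangMills): THE PX LEADER INTEGRAL OF THE ALIGNED FRAME AGAINST THE PROFILE (hCore F5c, region PX)
# (cell ym-idea-1, skeleton ➎, `stub_core_tip`, the core; free-hands support of ⟨stmt-QuantumFields-24197⟩ `SwapVirialDeficit.SwapGluedStiffness`)

Pure analysis, no deficit.  On the region `PX = {|y|² ≤ |x|², σ < |x|²}` (`σ = (1+δt²)⁻¹`) the leader majorant of ✓`tipPX_pointwise`,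
`w(x)e^{−β₁·2σ|x⊥|²∕(1+|x|²)} · w(y)e^{−β₃·Cross(x,y)} · D(√|x|², x·y∕√|x|²)` (`D ≥ 0` measurable — the reference factor `(√det A₀(gnoBase p′))⁻¹`), integrates to
★★★ `lintegral_PX_main_le` —
`∫⁻_{PX} … ≤ ofReal((3π+48)π²∕(β₁β₃)) · ∫⁻_p Profile(δt,p)·(1+p₁²)⁻¹(1+p₂²)⁻¹·D(p) dp`, `Profile = (1+δt²)²∕(1+h(p)(1+δt²))`:
Tonelli (restricted product ⟶ `∫⁻_x 𝟙{σ<|x|²} ∫⁻_y 𝟙{|y|²≤|x|²}`), ✓`lintegral_transverse_le` (y), ✓`lintegral_axial_cones_le` (x, `Ψ(N) = π²(1+N)∕(4β₃N)·∫⁻_{b²≤N}(1+b²)⁻¹D(√N,b)`),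
the reflection `a ↦ |a|` (`∫⁻_ℝ G(|a|) ≤ 2∫⁻_{a≥0} G(a)`, ✓`Measure.map_neg_eq_self`), and LEAD g100's ✓`profile_ge_of_PX`
(`(a²(1+b²))⁻¹ ≤ 4σ·Profile·w₀` on `σ < a²`, `b² ≤ a²`) — the `σ` of the soft Gaussian cancels the `σ` of the profile exactly.

HONEST LABEL: one analytic brick; `leaderLayer_PX∕PY` (pointwise majorant + tails + constants), `hLLm`, hCore, `stub_core_tip`, ⟨24197⟩ ∕ ⟨24194⟩ remain OPEN; own crux
⟨22884⟩ `LargeFieldMassRefinementTail` OPEN (blocked-on ⟨19935⟩); the Yang–Mills mass gap is NOT proved; no summit is proved by a line.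
THEOREMS ONLY (0 `def`, 0 `sorry`, no instance), standard axioms.  Width seat ym-line-sfw-p2-w2 g61 (cell ym-idea-1, free hands), `--supports stmt-QuantumFields-24197`.
References: [folklore].
-/

set_option autoImplicit false

noncomputable section

open MeasureTheory Set
open scoped BigOperators ENNReal

namespace Summit.QuantumFields.YangMills.Theorems.SwapVirialDeficit.SectorLaplace

open Summit.QuantumFields.YangMills.Theorems.SwapVirialDeficit.BlowUpRing
open Summit.QuantumFields.YangMills.Theorems.SwapVirialDeficit.Gnomonic (normSq3 normSq3_smul normSq3_nonneg gnomonicWeight gnomonicWeight_pos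
  gnomonicWeight_le_one)

/-! ## §1 The reflection `a ↦ |a|` and the radial–to–plane step -/

/-- `∫⁻_ℝ G(|a|) da ≤ 2·∫⁻_ℝ 𝟙{0 ≤ a}·G(a) da` for measurable `G ≥ 0`. [folklore] -/
theorem lintegral_comp_abs_le {G : ℝ → ℝ≥0∞} (hG : Measurable G) :
    ∫⁻ a : ℝ, G |a| ≤ 2 * ∫⁻ a : ℝ, {a : ℝ | 0 ≤ a}.indicator G a := by
  have hS : MeasurableSet {a : ℝ | 0 ≤ a} := measurableSet_le measurable_const measurable_id
  have hGi : Measurable ({a : ℝ | 0 ≤ a}.indicator G) := hG.indicator hS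
  have hpt : ∀ a : ℝ, G |a| ≤ {a : ℝ | 0 ≤ a}.indicator G a + {a : ℝ | 0 ≤ a}.indicator G (-a) := by
    intro a
    rcases le_or_gt 0 a with ha | ha
    · rw [abs_of_nonneg ha, Set.indicator_of_mem (by exact ha)]; exact le_self_add
    · rw [abs_of_neg ha, Set.indicator_of_mem (show -a ∈ {a : ℝ | 0 ≤ a} by simp only [Set.mem_setOf_eq]; linarith)]; exact le_add_self
  have hneg : ∫⁻ a : ℝ, {a : ℝ | 0 ≤ a}.indicator G (-a) = ∫⁻ a : ℝ, {a : ℝ | 0 ≤ a}.indicator G a := by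
    rw [← lintegral_map hGi measurable_neg, Measure.map_neg_eq_self]
  calc ∫⁻ a : ℝ, G |a| ≤ ∫⁻ a : ℝ, ({a : ℝ | 0 ≤ a}.indicator G a + {a : ℝ | 0 ≤ a}.indicator G (-a)) := lintegral_mono hpt
    _ = (∫⁻ a : ℝ, {a : ℝ | 0 ≤ a}.indicator G a) + ∫⁻ a : ℝ, {a : ℝ | 0 ≤ a}.indicator G (-a) := lintegral_add_left hGi _
    _ = 2 * ∫⁻ a : ℝ, {a : ℝ | 0 ≤ a}.indicator G a := by rw [hneg, two_mul]

/-! ## §2 The PX main integral -/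

set_option maxHeartbeats 1600000 in
/-- ★★★ **THE PX LEADER INTEGRAL AGAINST THE PROFILE** (see the file header). [folklore] -/
theorem lintegral_PX_main_le {δt β₁ β₃ : ℝ} (hδt : 1 ≤ δt) (hβ₁ : 0 < β₁) (hβ₃ : 0 < β₃) {D : ℝ × ℝ → ℝ≥0∞} (hD : Measurable D) :
    ∫⁻ xy in {xy : (Fin 3 → ℝ) × (Fin 3 → ℝ) | normSq3 xy.2 ≤ normSq3 xy.1 ∧ (1 + δt ^ 2)⁻¹ < normSq3 xy.1},
        ENNReal.ofReal (gnomonicWeight xy.1 * Real.exp (-(β₁ * (2 * (1 + δt ^ 2)⁻¹ * (xy.1 1 ^ 2 + xy.1 2 ^ 2) / (1 + normSq3 xy.1))))) *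
        (ENNReal.ofReal (gnomonicWeight xy.2 * Real.exp (-(β₃ * (4 * ((xy.1 1 * xy.2 2 - xy.1 2 * xy.2 1) ^ 2 + (xy.1 2 * xy.2 0 - xy.1 0 * xy.2 2) ^ 2 +
            (xy.1 0 * xy.2 1 - xy.1 1 * xy.2 0) ^ 2) / ((1 + normSq3 xy.1) * (1 + normSq3 xy.2)))))) *
          D (Real.sqrt (normSq3 xy.1), (Real.sqrt (normSq3 xy.1))⁻¹ * (xy.1 0 * xy.2 0 + xy.1 1 * xy.2 1 + xy.1 2 * xy.2 2))) ≤
      ENNReal.ofReal ((3 * Real.pi + 48) * Real.pi ^ 2 / (β₁ * β₃)) *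
        ∫⁻ p : ℝ × ℝ, ENNReal.ofReal ((1 + δt ^ 2) ^ 2 / (1 + (p.1 ^ 2 / (1 + p.1 ^ 2) + p.2 ^ 2 / (1 + p.2 ^ 2)) * (1 + δt ^ 2)) *
          ((1 + p.1 ^ 2)⁻¹ * (1 + p.2 ^ 2)⁻¹)) * D p := by
  set σ : ℝ := (1 + δt ^ 2)⁻¹ with hσdef
  have hσ : 0 < σ := by positivity
  have hmeasN : Measurable (normSq3 : (Fin 3 → ℝ) → ℝ) := continuous_normSq3.measurable
  have hw : Measurable (gnomonicWeight : (Fin 3 → ℝ) → ℝ) := by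
    unfold gnomonicWeight; exact ((measurable_const.add hmeasN).inv).pow_const 2
  -- the pieces of the integrand
  set Ex : (Fin 3 → ℝ) → ℝ≥0∞ := fun x => ENNReal.ofReal (gnomonicWeight x * Real.exp (-(β₁ * (2 * σ * (x 1 ^ 2 + x 2 ^ 2) / (1 + normSq3 x))))) with hEx
  set Fy : (Fin 3 → ℝ) → (Fin 3 → ℝ) → ℝ≥0∞ := fun x y =>
    ENNReal.ofReal (gnomonicWeight y * Real.exp (-(β₃ * (4 * ((x 1 * y 2 - x 2 * y 1) ^ 2 + (x 2 * y 0 - x 0 * y 2) ^ 2 + (x 0 * y 1 - x 1 * y 0) ^ 2) /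
        ((1 + normSq3 x) * (1 + normSq3 y)))))) *
      D (Real.sqrt (normSq3 x), (Real.sqrt (normSq3 x))⁻¹ * (x 0 * y 0 + x 1 * y 1 + x 2 * y 2)) with hFy
  set S : Set ((Fin 3 → ℝ) × (Fin 3 → ℝ)) := {xy | normSq3 xy.2 ≤ normSq3 xy.1 ∧ σ < normSq3 xy.1} with hSdef
  have hS : MeasurableSet S := by
    rw [hSdef]
    exact (measurableSet_le (hmeasN.comp measurable_snd) (hmeasN.comp measurable_fst)).inter (measurableSet_lt measurable_const (hmeasN.comp measurable_fst))
  have hExm : Measurable Ex := by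
    rw [hEx]
    refine Measurable.ennreal_ofReal (hw.mul (Real.measurable_exp.comp ?_))
    exact ((Measurable.div (by fun_prop) (measurable_const.add hmeasN)).const_mul β₁).neg
  have hFym : Measurable (Function.uncurry Fy) := by
    rw [hFy]
    refine Measurable.mul (Measurable.ennreal_ofReal ((hw.comp measurable_snd).mul (Real.measurable_exp.comp ?_))) (hD.comp ?_)
    · refine ((Measurable.div (by fun_prop) ?_).const_mul β₃).neg
      exact (measurable_const.add (hmeasN.comp measurable_fst)).mul (measurable_const.add (hmeasN.comp measurable_snd))
    · exact ((hmeasN.comp measurable_fst).sqrt).prodMk (((hmeasN.comp measurable_fst).sqrt.inv).mul (by fun_prop))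
  -- Tonelli on the restricted product
  have hTon : ∫⁻ xy in S, Ex xy.1 * Fy xy.1 xy.2 =
      ∫⁻ x : Fin 3 → ℝ, {x : Fin 3 → ℝ | σ < normSq3 x}.indicator (fun x => Ex x *
        ∫⁻ y : Fin 3 → ℝ, {y : Fin 3 → ℝ | normSq3 y ≤ normSq3 x}.indicator (fun y => Fy x y) y) x := by
    have hm : Measurable fun xy : (Fin 3 → ℝ) × (Fin 3 → ℝ) => Ex xy.1 * Fy xy.1 xy.2 := (hExm.comp measurable_fst).mul hFym
    rw [← lintegral_indicator hS, show (volume : Measure ((Fin 3 → ℝ) × (Fin 3 → ℝ))) = (volume : Measure (Fin 3 → ℝ)).prod volume from rfl,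
      lintegral_prod _ (hm.indicator hS).aemeasurable]
    refine lintegral_congr fun x => ?_
    by_cases hx : σ < normSq3 x
    · rw [Set.indicator_of_mem (by exact hx)]
      have e : (fun y => S.indicator (fun xy : (Fin 3 → ℝ) × (Fin 3 → ℝ) => Ex xy.1 * Fy xy.1 xy.2) (x, y)) =
          fun y => Ex x * {y : Fin 3 → ℝ | normSq3 y ≤ normSq3 x}.indicator (fun y => Fy x y) y := by
        funext y
        by_cases hy : normSq3 y ≤ normSq3 x
        · rw [Set.indicator_of_mem (show (x, y) ∈ S from ⟨hy, hx⟩), Set.indicator_of_mem (by exact hy)]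
        · rw [Set.indicator_of_notMem (show (x, y) ∉ S from fun h => hy h.1), Set.indicator_of_notMem (by exact hy), mul_zero]
      rw [e, lintegral_const_mul' _ _ ENNReal.ofReal_ne_top]
    · rw [Set.indicator_of_notMem (by exact hx)]
      have e : (fun y => S.indicator (fun xy : (Fin 3 → ℝ) × (Fin 3 → ℝ) => Ex xy.1 * Fy xy.1 xy.2) (x, y)) = fun _ => 0 := by
        funext y; rw [Set.indicator_of_notMem (show (x, y) ∉ S from fun h => hx h.2)]
      rw [e, lintegral_zero]
  -- the transverse step
  set Ib : ℝ → ℝ≥0∞ := fun N => ∫⁻ b : ℝ, {b : ℝ | b ^ 2 ≤ N}.indicator (fun b => ENNReal.ofReal ((1 + b ^ 2)⁻¹) * D (Real.sqrt N, b)) b with hIb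
  have hg₂m : Measurable fun q : ℝ × ℝ => {q : ℝ × ℝ | q.2 ^ 2 ≤ q.1}.indicator (fun q => ENNReal.ofReal ((1 + q.2 ^ 2)⁻¹) * D (Real.sqrt q.1, q.2)) q :=
    Measurable.indicator ((Measurable.ennreal_ofReal (by fun_prop)).mul (hD.comp (measurable_fst.sqrt.prodMk measurable_snd)))
      (measurableSet_le ((measurable_snd.pow_const 2)) measurable_fst)
  have hIbe : Ib = fun N => ∫⁻ b : ℝ, {q : ℝ × ℝ | q.2 ^ 2 ≤ q.1}.indicator (fun q => ENNReal.ofReal ((1 + q.2 ^ 2)⁻¹) * D (Real.sqrt q.1, q.2)) (N, b) := by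
    funext N
    rw [hIb]
    refine lintegral_congr fun b => ?_
    by_cases hb : b ^ 2 ≤ N
    · rw [Set.indicator_of_mem (by exact hb), Set.indicator_of_mem (by exact hb)]
    · rw [Set.indicator_of_notMem (by exact hb), Set.indicator_of_notMem (by exact hb)]
  have hIbm : Measurable Ib := by rw [hIbe]; exact hg₂m.lintegral_prod_right'
  have htrans : ∀ x : Fin 3 → ℝ, σ < normSq3 x →
      ∫⁻ y : Fin 3 → ℝ, {y : Fin 3 → ℝ | normSq3 y ≤ normSq3 x}.indicator (fun y => Fy x y) y ≤
        ENNReal.ofReal (Real.pi ^ 2 * (1 + normSq3 x) / (4 * β₃ * normSq3 x)) * Ib (normSq3 x) := by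
    intro x hx
    have h := lintegral_transverse_le (x := x) (hσ.trans hx) hβ₃ hD
    rw [hFy, hIb]
    exact h
  -- the axial cone step
  set Ψ : ℝ → ℝ≥0∞ := fun N => ENNReal.ofReal (Real.pi ^ 2 * (1 + N) / (4 * β₃ * N)) * Ib N with hΨ
  have hΨm : Measurable Ψ := by rw [hΨ]; exact (Measurable.ennreal_ofReal (by fun_prop)).mul hIbm
  have hcones := lintegral_axial_cones_le hσ hβ₁ hΨm
  -- chain so far
  have hchain : ∫⁻ xy in S, Ex xy.1 * Fy xy.1 xy.2 ≤
      ENNReal.ofReal ((3 * Real.pi + 48) / (2 * β₁ * σ)) * ∫⁻ a : ℝ, {a : ℝ | σ < a ^ 2}.indicator (fun a => ENNReal.ofReal ((1 + a ^ 2)⁻¹) * Ψ (a ^ 2)) a := by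
    rw [hTon]
    refine le_trans (lintegral_mono fun x => ?_) hcones
    by_cases hx : σ < normSq3 x
    · rw [Set.indicator_of_mem (by exact hx), Set.indicator_of_mem (by exact hx), hEx, hΨ]
      exact mul_le_mul' le_rfl (htrans x hx)
    · rw [Set.indicator_of_notMem (by exact hx), Set.indicator_of_notMem (by exact hx)]
  -- the radial integrand through `G(|a|)`
  set T : Set (ℝ × ℝ) := {q : ℝ × ℝ | σ < q.1 ^ 2 ∧ q.2 ^ 2 ≤ q.1 ^ 2} with hTdef
  have hT : MeasurableSet T := by
    rw [hTdef]
    exact (measurableSet_lt measurable_const (measurable_fst.pow_const 2)).inter (measurableSet_le (measurable_snd.pow_const 2) (measurable_fst.pow_const 2))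
  set g : ℝ × ℝ → ℝ≥0∞ := fun q => T.indicator (fun q => ENNReal.ofReal ((q.1 ^ 2 * (1 + q.2 ^ 2))⁻¹) * D q) q with hgdef
  have hgm : Measurable g := by rw [hgdef]; exact Measurable.indicator ((Measurable.ennreal_ofReal (by fun_prop)).mul hD) hT
  set G : ℝ → ℝ≥0∞ := fun c => ∫⁻ b : ℝ, g (c, b) with hG
  have hGm : Measurable G := by rw [hG]; exact hgm.lintegral_prod_right'
  have hrad : ∀ a : ℝ, {a : ℝ | σ < a ^ 2}.indicator (fun a => ENNReal.ofReal ((1 + a ^ 2)⁻¹) * Ψ (a ^ 2)) a =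
      ENNReal.ofReal (Real.pi ^ 2 / (4 * β₃)) * G |a| := by
    intro a
    have hsq : Real.sqrt (a ^ 2) = |a| := Real.sqrt_sq_eq_abs a
    have habs2 : |a| ^ 2 = a ^ 2 := sq_abs a
    by_cases ha : σ < a ^ 2
    · have ha0 : 0 < a ^ 2 := hσ.trans ha
      rw [Set.indicator_of_mem (by exact ha), hΨ, hIb, hG]
      simp only
      rw [hsq, ← mul_assoc, ← ENNReal.ofReal_mul (by positivity),
        show (1 + a ^ 2)⁻¹ * (Real.pi ^ 2 * (1 + a ^ 2) / (4 * β₃ * a ^ 2)) = Real.pi ^ 2 / (4 * β₃) * (a ^ 2)⁻¹ by field_simp,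
        ENNReal.ofReal_mul (by positivity), mul_assoc]
      congr 1
      have hmb : Measurable fun b : ℝ => {b : ℝ | b ^ 2 ≤ a ^ 2}.indicator (fun b => ENNReal.ofReal ((1 + b ^ 2)⁻¹) * D (|a|, b)) b :=
        Measurable.indicator ((Measurable.ennreal_ofReal (by fun_prop)).mul (hD.comp (measurable_const.prodMk measurable_id)))
          (measurableSet_le (by fun_prop) measurable_const)
      rw [← lintegral_const_mul _ hmb]
      refine lintegral_congr fun b => ?_
      rw [hgdef]; simp only
      by_cases hb : b ^ 2 ≤ a ^ 2
      · have hmem : (|a|, b) ∈ T := by rw [hTdef]; simp only [Set.mem_setOf_eq]; rw [habs2]; exact ⟨ha, hb⟩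
        rw [Set.indicator_of_mem (by exact hb), Set.indicator_of_mem hmem]
        simp only
        rw [habs2, ← mul_assoc, ← ENNReal.ofReal_mul (by positivity), mul_inv]
      · have hnm : (|a|, b) ∉ T := by rw [hTdef]; simp only [Set.mem_setOf_eq]; rw [habs2]; exact fun h => hb h.2
        rw [Set.indicator_of_notMem (by exact hb), Set.indicator_of_notMem hnm, mul_zero]
    · rw [Set.indicator_of_notMem (by exact ha)]
      have hG0 : G |a| = 0 := by
        rw [hG]; simp only
        refine (lintegral_congr fun b => ?_).trans lintegral_zero
        rw [hgdef]; simp only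
        have hnm : (|a|, b) ∉ T := by rw [hTdef]; simp only [Set.mem_setOf_eq]; rw [habs2]; exact fun h => ha h.1
        rw [Set.indicator_of_notMem hnm]
      rw [hG0, mul_zero]
  -- the plane step with the profile
  have hplane : ∫⁻ a : ℝ, {a : ℝ | 0 ≤ a}.indicator G a ≤
      ENNReal.ofReal (4 * σ) * ∫⁻ p : ℝ × ℝ, ENNReal.ofReal ((1 + δt ^ 2) ^ 2 / (1 + (p.1 ^ 2 / (1 + p.1 ^ 2) + p.2 ^ 2 / (1 + p.2 ^ 2)) * (1 + δt ^ 2)) *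
        ((1 + p.1 ^ 2)⁻¹ * (1 + p.2 ^ 2)⁻¹)) * D p := by
    have hP : MeasurableSet {p : ℝ × ℝ | 0 ≤ p.1} := measurableSet_le measurable_const measurable_fst
    have e1 : ∫⁻ a : ℝ, {a : ℝ | 0 ≤ a}.indicator G a = ∫⁻ p : ℝ × ℝ, {p : ℝ × ℝ | 0 ≤ p.1}.indicator g p := by
      rw [show (volume : Measure (ℝ × ℝ)) = (volume : Measure ℝ).prod volume from rfl, lintegral_prod _ (hgm.indicator hP).aemeasurable]
      refine lintegral_congr fun a => ?_
      by_cases ha : 0 ≤ a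
      · rw [Set.indicator_of_mem (by exact ha), hG]; simp only
        refine lintegral_congr fun b => ?_
        rw [Set.indicator_of_mem (show (a, b) ∈ {p : ℝ × ℝ | 0 ≤ p.1} from ha)]
      · rw [Set.indicator_of_notMem (by exact ha)]; symm
        refine (lintegral_congr fun b => ?_).trans lintegral_zero
        rw [Set.indicator_of_notMem (show (a, b) ∉ {p : ℝ × ℝ | 0 ≤ p.1} from ha)]
    rw [e1, ← lintegral_const_mul' _ _ ENNReal.ofReal_ne_top]
    refine lintegral_mono fun p => ?_
    by_cases hp1 : (0 : ℝ) ≤ p.1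
    · rw [Set.indicator_of_mem (by exact hp1), hgdef]; simp only
      by_cases hp : p ∈ T
      · have hp' : σ < p.1 ^ 2 ∧ p.2 ^ 2 ≤ p.1 ^ 2 := by rw [hTdef] at hp; exact hp
        rw [Set.indicator_of_mem hp, ← mul_assoc, ← ENNReal.ofReal_mul (by positivity)]
        refine mul_le_mul' (ENNReal.ofReal_le_ofReal ?_) le_rfl
        have hprof := profile_ge_of_PX (δt := δt) (a := p.1) (b := p.2) (by rw [← hσdef]; exact hp'.1) hp'.2
        have ha0 : 0 < p.1 ^ 2 := hσ.trans hp'.1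
        have hq0 : 0 ≤ (1 + δt ^ 2) ^ 2 / (1 + (p.1 ^ 2 / (1 + p.1 ^ 2) + p.2 ^ 2 / (1 + p.2 ^ 2)) * (1 + δt ^ 2)) := by positivity
        calc (p.1 ^ 2 * (1 + p.2 ^ 2))⁻¹ = σ * ((1 + δt ^ 2) * (1 + p.1 ^ 2) / p.1 ^ 2) * ((1 + p.1 ^ 2)⁻¹ * (1 + p.2 ^ 2)⁻¹) := by
              rw [hσdef]; field_simp
          _ ≤ σ * (4 * ((1 + δt ^ 2) ^ 2 / (1 + (p.1 ^ 2 / (1 + p.1 ^ 2) + p.2 ^ 2 / (1 + p.2 ^ 2)) * (1 + δt ^ 2)))) * ((1 + p.1 ^ 2)⁻¹ * (1 + p.2 ^ 2)⁻¹) :=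
              mul_le_mul_of_nonneg_right (mul_le_mul_of_nonneg_left hprof hσ.le) (by positivity)
          _ = 4 * σ * ((1 + δt ^ 2) ^ 2 / (1 + (p.1 ^ 2 / (1 + p.1 ^ 2) + p.2 ^ 2 / (1 + p.2 ^ 2)) * (1 + δt ^ 2)) * ((1 + p.1 ^ 2)⁻¹ * (1 + p.2 ^ 2)⁻¹)) := by ring
      · rw [Set.indicator_of_notMem hp]; exact zero_le
    · rw [Set.indicator_of_notMem (by exact hp1)]; exact zero_le
  -- assemble
  have hβσ : (3 * Real.pi + 48) / (2 * β₁ * σ) * (Real.pi ^ 2 / (4 * β₃)) * 2 * (4 * σ) = (3 * Real.pi + 48) * Real.pi ^ 2 / (β₁ * β₃) := by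
    field_simp
  have hconst : ENNReal.ofReal ((3 * Real.pi + 48) * Real.pi ^ 2 / (β₁ * β₃)) =
      ENNReal.ofReal ((3 * Real.pi + 48) / (2 * β₁ * σ)) * (ENNReal.ofReal (Real.pi ^ 2 / (4 * β₃)) * (2 * ENNReal.ofReal (4 * σ))) := by
    rw [← hβσ, ENNReal.ofReal_mul (by positivity), ENNReal.ofReal_mul (by positivity), ENNReal.ofReal_mul (by positivity),
      show ENNReal.ofReal 2 = (2 : ℝ≥0∞) by simp]
    ring
  calc ∫⁻ xy in S, Ex xy.1 * Fy xy.1 xy.2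
      ≤ ENNReal.ofReal ((3 * Real.pi + 48) / (2 * β₁ * σ)) * ∫⁻ a : ℝ, {a : ℝ | σ < a ^ 2}.indicator (fun a => ENNReal.ofReal ((1 + a ^ 2)⁻¹) * Ψ (a ^ 2)) a := hchain
    _ = ENNReal.ofReal ((3 * Real.pi + 48) / (2 * β₁ * σ)) * (ENNReal.ofReal (Real.pi ^ 2 / (4 * β₃)) * ∫⁻ a : ℝ, G |a|) := by
        congr 1
        rw [← lintegral_const_mul' _ _ ENNReal.ofReal_ne_top]
        exact lintegral_congr hrad
    _ ≤ ENNReal.ofReal ((3 * Real.pi + 48) / (2 * β₁ * σ)) * (ENNReal.ofReal (Real.pi ^ 2 / (4 * β₃)) * (2 * ∫⁻ a : ℝ, {a : ℝ | 0 ≤ a}.indicator G a)) :=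
        mul_le_mul' le_rfl (mul_le_mul' le_rfl (lintegral_comp_abs_le hGm))
    _ ≤ ENNReal.ofReal ((3 * Real.pi + 48) / (2 * β₁ * σ)) * (ENNReal.ofReal (Real.pi ^ 2 / (4 * β₃)) * (2 * (ENNReal.ofReal (4 * σ) *
          ∫⁻ p : ℝ × ℝ, ENNReal.ofReal ((1 + δt ^ 2) ^ 2 / (1 + (p.1 ^ 2 / (1 + p.1 ^ 2) + p.2 ^ 2 / (1 + p.2 ^ 2)) * (1 + δt ^ 2)) *
            ((1 + p.1 ^ 2)⁻¹ * (1 + p.2 ^ 2)⁻¹)) * D p))) :=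
        mul_le_mul' le_rfl (mul_le_mul' le_rfl (mul_le_mul' le_rfl hplane))
    _ = ENNReal.ofReal ((3 * Real.pi + 48) * Real.pi ^ 2 / (β₁ * β₃)) *
          ∫⁻ p : ℝ × ℝ, ENNReal.ofReal ((1 + δt ^ 2) ^ 2 / (1 + (p.1 ^ 2 / (1 + p.1 ^ 2) + p.2 ^ 2 / (1 + p.2 ^ 2)) * (1 + δt ^ 2)) *
            ((1 + p.1 ^ 2)⁻¹ * (1 + p.2 ^ 2)⁻¹)) * D p := by
        rw [hconst]
        ring

end Summit.QuantumFields.YangMills.Theorems.SwapVirialDeficit.SectorLaplace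

end
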